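import Mathlib
import Summits.MatrixMultiplication.MatrixMultiplication.Theorems.GradedDesignFamily.Negative.SubfieldCellSlicedCounting

/-!
# Subfield cell — auxiliary counting for (S″) (`SubfieldCellStructureTriple.lean`)

Unit `b2b-lgcu-subfield` (gen 20), supporting `stmt-MatrixMultiplication-7610`.  Small lemmas used by
`structureSliced_of_tripleProduct`: `|ker det| ≤ |SL₂|`, `q²(q−1) ≤ |SL₂(k)|` over `ℝ`, the
`M¹⁵`-approximate group `A⁴ = (A²)²` of an `M`-approximate group `A`, and the real-arithmetic endgame
turning the triple-product bound into `q⁶ ≤ 16 M³ C₂ · t`.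

HONEST FRAMING: bookkeeping toward an unconditional `¬ stub_subfieldCell`; NOT summit progress.
Sorry-free. [folklore]
-/

set_option linter.dupNamespace false

open scoped Pointwise

namespace Summit.MatrixMultiplication.MatrixMultiplication.Theorems.GradedDesignFamily.Negative

/-- `|ker (det : GL₂(K) → Kˣ)| ≤ |SL₂(K)|` (the obvious injection). [folklore] -/
theorem natCard_ker_det_le_card (K : Type) [Field K] [Fintype K] [DecidableEq K] :
    Nat.card (Matrix.GeneralLinearGroup.det : Matrix.GeneralLinearGroup (Fin 2) K →* Kˣ).ker ≤
      Fintype.card (Matrix.SpecialLinearGroup (Fin 2) K) := by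
  rw [← Nat.card_eq_fintype_card]
  refine Nat.card_le_card_of_injective
    (fun g => (⟨((g : Matrix.GeneralLinearGroup (Fin 2) K) : Matrix (Fin 2) (Fin 2) K), ?_⟩ :
      Matrix.SpecialLinearGroup (Fin 2) K)) ?_
  · rw [← Matrix.GeneralLinearGroup.val_det_apply, MonoidHom.mem_ker.1 g.2, Units.val_one]
  · intro g g' e
    exact Subtype.ext (Units.ext (congr_arg
      (fun s : Matrix.SpecialLinearGroup (Fin 2) K => (s : Matrix (Fin 2) (Fin 2) K)) e))

/-- `q²(q − 1) ≤ |SL₂(k)|` over `ℝ`, `q = |k|`. [folklore] -/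
theorem card_specialLinearGroup_fin_two_ge_real (k : Type) [Field k] [Fintype k] [DecidableEq k] :
    (Fintype.card k : ℝ) * ((Fintype.card k : ℝ) * ((Fintype.card k : ℝ) - 1)) ≤
      (Fintype.card (Matrix.SpecialLinearGroup (Fin 2) k) : ℝ) := by
  have h := (card_ker_det_fin_two_ge k).trans (natCard_ker_det_le_card k)
  have h1 : 1 ≤ Fintype.card k := Fintype.card_pos
  have h' : ((Fintype.card k * (Fintype.card k * (Fintype.card k - 1)) : ℕ) : ℝ) ≤
      (Fintype.card (Matrix.SpecialLinearGroup (Fin 2) k) : ℝ) := by exact_mod_cast h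
  push_cast [Nat.cast_sub h1] at h'
  exact h'

/-- `A⁴ = (A²)²` is an `M¹⁵`-approximate group when `A` is an `M`-approximate group. [folklore] -/
theorem isApproximateSubgroup_sq_sq {G : Type} [Group G] [DecidableEq G] {M : ℝ} {A : Finset G}
    (happ : IsApproximateSubgroup M (A : Set G)) :
    IsApproximateSubgroup ((M ^ 5) ^ 3) (↑((A ^ 2) ^ 2) : Set G) := by
  have h1 : (1 : G) ∈ A := Finset.mem_coe.1 happ.one_mem
  have hAinv : A⁻¹ = A := by rw [← Finset.coe_inj, Finset.coe_inv, happ.inv_eq_self]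
  have h1A2 : (1 : G) ∈ A ^ 2 := by
    have h11 := Finset.mul_mem_mul h1 h1
    rwa [mul_one, ← sq] at h11
  have hA2inv : (A ^ 2)⁻¹ = A ^ 2 := by rw [← inv_pow, hAinv]
  have hAA2 : A ⊆ A ^ 2 := by
    rw [sq]; exact Finset.subset_mul_left A h1
  have hcard6 : (((A ^ 2) ^ 3).card : ℝ) ≤ M ^ 5 * (A ^ 2).card := by
    rw [← pow_mul]
    have h6 := happ.card_pow_le (n := 6)
    norm_num at h6
    have hA_le : (A.card : ℝ) ≤ (A ^ 2).card := by exact_mod_cast Finset.card_le_card hAA2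
    have hM : 0 ≤ M ^ 5 := pow_nonneg (by linarith [happ.one_le]) 5
    calc (((A ^ (2 * 3))).card : ℝ) = ((A ^ 6).card : ℝ) := by norm_num
      _ ≤ M ^ 5 * A.card := h6
      _ ≤ M ^ 5 * (A ^ 2).card := by gcongr
  have h := IsApproximateSubgroup.of_small_tripling h1A2 hA2inv hcard6
  simpa only [← Finset.coe_pow] using h

/-- `|(A²)²| ≤ M³|A|` for an `M`-approximate group `A`. [folklore] -/
theorem card_sq_sq_le {G : Type} [Group G] [DecidableEq G] {M : ℝ} {A : Finset G}
    (happ : IsApproximateSubgroup M (A : Set G)) :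
    ((((A ^ 2) ^ 2)).card : ℝ) ≤ M ^ 3 * A.card := by
  rw [← pow_mul]
  have h4 := happ.card_pow_le (n := 4)
  norm_num at h4
  calc (((A ^ (2 * 2))).card : ℝ) = ((A ^ 4).card : ℝ) := by norm_num
    _ ≤ M ^ 3 * A.card := h4

/-- `A ⊆ (A²)²` and `A² A² A² A² A² ⊆ ((A²)²)⁴` when `1 ∈ A`. [folklore] -/
theorem subset_sq_sq {G : Type} [Group G] [DecidableEq G] {A : Finset G} (h1 : (1 : G) ∈ A) :
    A ⊆ (A ^ 2) ^ 2 ∧ A ^ 2 * A ^ 2 * A ^ 2 * A ^ 2 * A ^ 2 ⊆ ((A ^ 2) ^ 2) ^ 4 := by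
  have hAA2 : A ⊆ A ^ 2 := by
    rw [sq]; exact Finset.subset_mul_left A h1
  have h1A2 : (1 : G) ∈ A ^ 2 := hAA2 h1
  refine ⟨hAA2.trans (by rw [sq (A ^ 2)]; exact Finset.subset_mul_left _ h1A2), ?_⟩
  have e10 : A ^ 2 * A ^ 2 * A ^ 2 * A ^ 2 * A ^ 2 = A ^ 10 := by
    rw [← pow_add, ← pow_add, ← pow_add, ← pow_add]
  rw [e10, ← pow_mul, ← pow_mul]
  exact Finset.pow_subset_pow_right h1 (by norm_num)

/-- The real-arithmetic endgame of (S″): from `q²(q−1) ≤ M p`, `q ≥ 2M|C₁| + 1`, `q ≥ 2` and the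
triple-product bound `p (p − C₁q²) p ≤ C₂ q³ t` conclude `q⁶ ≤ 16 M³ C₂ t`. [folklore] -/
theorem tripleProduct_arith {M C₁ C₂ q p t : ℝ} (hM0 : 0 < M) (hq2 : 2 ≤ q)
    (hqC1 : 2 * M * |C₁| + 1 ≤ q) (hp0 : 0 ≤ p) (hpM : q * (q * (q - 1)) ≤ M * p)
    (hKL : p * (p - C₁ * q ^ 2) * p ≤ C₂ * q ^ 3 * t) :
    q ^ 6 ≤ 16 * M ^ 3 * C₂ * t := by
  have hqpos : 0 < q := by linarith
  have hq1 : q / 2 ≤ q - 1 := by linarith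
  have hp3 : q ^ 3 ≤ 2 * M * p := by
    have h1' : q * (q * (q / 2)) ≤ q * (q * (q - 1)) :=
      mul_le_mul_of_nonneg_left (mul_le_mul_of_nonneg_left hq1 hqpos.le) hqpos.le
    have e : q ^ 3 = 2 * (q * (q * (q / 2))) := by ring
    linarith [h1'.trans hpM]
  have hC1 : C₁ * q ^ 2 ≤ p / 2 := by
    have ha : C₁ ≤ |C₁| := le_abs_self C₁
    have h1' : C₁ * q ^ 2 ≤ |C₁| * q ^ 2 := by gcongr
    have h2' : 2 * M * |C₁| ≤ q - 1 := by linarith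
    have h3' : q ^ 2 * (2 * M * |C₁|) ≤ M * p := by
      have h5 : q ^ 2 * (2 * M * |C₁|) ≤ q ^ 2 * (q - 1) :=
        mul_le_mul_of_nonneg_left h2' (by positivity)
      have e : q ^ 2 * (q - 1) = q * (q * (q - 1)) := by ring
      linarith [hpM]
    have h4' : |C₁| * q ^ 2 ≤ p / 2 := by
      have h6 : M * (2 * |C₁| * q ^ 2) ≤ M * p := by
        have e : M * (2 * |C₁| * q ^ 2) = q ^ 2 * (2 * M * |C₁|) := by ring
        linarith [h3']
      have h7 := le_of_mul_le_mul_left h6 hM0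
      linarith
    exact h1'.trans h4'
  have hmid : p / 2 ≤ p - C₁ * q ^ 2 := by linarith
  have hKL' : p * (p / 2) * p ≤ C₂ * q ^ 3 * t := by
    have h8 : p * (p / 2) * p ≤ p * (p - C₁ * q ^ 2) * p := by
      have h9 := mul_le_mul_of_nonneg_left hmid hp0
      exact mul_le_mul_of_nonneg_right h9 hp0
    exact h8.trans hKL
  have hq9 : q ^ 9 ≤ 8 * M ^ 3 * p ^ 3 := by
    have h8 := pow_le_pow_left₀ (by positivity) hp3 3
    have e1 : (q ^ 3) ^ 3 = q ^ 9 := by ring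
    have e2 : (2 * M * p) ^ 3 = 8 * M ^ 3 * p ^ 3 := by ring
    linarith [h8, e1, e2]
  have hM3 : (0 : ℝ) ≤ 8 * M ^ 3 := by positivity
  have h9 : 8 * M ^ 3 * p ^ 3 ≤ 8 * M ^ 3 * (2 * (C₂ * q ^ 3 * t)) := by
    apply mul_le_mul_of_nonneg_left _ hM3
    have e : p ^ 3 = 2 * (p * (p / 2) * p) := by ring
    linarith [hKL']
  have h' : q ^ 3 * (q ^ 6) ≤ q ^ 3 * (16 * M ^ 3 * C₂ * t) := by
    have e1 : q ^ 3 * (q ^ 6) = q ^ 9 := by ring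
    have e2 : q ^ 3 * (16 * M ^ 3 * C₂ * t) = 8 * M ^ 3 * (2 * (C₂ * q ^ 3 * t)) := by ring
    rw [e1, e2]
    exact hq9.trans h9
  exact le_of_mul_le_mul_left h' (by positivity)

end Summit.MatrixMultiplication.MatrixMultiplication.Theorems.GradedDesignFamily.Negative
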